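import Literature.NumberTheory.QuadraticFields.RingClassNumber
import Literature.Computability.Cryptography.HallgrenClassGroupReduction
import Literature.NumberTheory.QuadraticFields.BinaryQuadraticFormsRepresentation
import HarnessLib

/-!
# The form class group of discriminant `f² d_K` is the ring class group:
# `h(f² d_K) = |I_K(f)/P_{K,ℤ}(f)|` (Cox, Prop. 7.22 with Thm. 7.7), and `I_K(f) → Cl(𝓞 K)` is onto

Topic `NumberTheory/QuadraticFields`, namespace `Literature.NumberTheory.QuadraticFields.RingClass`
(continuing `RingClassOrder.lean`, `RingClassGroup.lean`). Everything here is PROVED (theorems only).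

Let `K` be an imaginary quadratic field with integral basis `(1, ω)`, `ω² = m + tω`
(`d_K = t² + 4m < 0`), `f ≥ 1`, `D = f² d_K`, `O_D` the tree's abstract order with its embedding
`ι : O_D → 𝓞 K` of `RingClassOrder.lean`. For a primitive positive definite form `q` of discriminant
`D` with `gcd(a_q, f) = 1` let `𝔄_q = 𝔞_q 𝓞 K` (`Ideal.map ι (fIdeal q)`), an ideal prime to `f`.

* `mk_formUnit_eq_of_properEquiv` — properly equivalent such forms give the same class in
  `I_K(f)/P_{K,ℤ}(f)` (if `x𝔞₁ = y𝔞₂` in `O` then `a₂ 𝔞₁ = γ 𝔞₂` with `γ ∈ O` of norm prime to `f`);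
* `properEquiv_of_mk_formUnit_eq` — conversely (Cox, Prop. 7.20/7.22: pull back by `ι⁻¹` using
  `comap_map_eq`, then Thm. 7.7(ii) for `O`, the tree's `classOf'_eq_classOf'_iff`);
* `exists_form_mk_eq` — every class of `I_K(f)/P_{K,ℤ}(f)` is `[𝔄_q]` (Prop. 7.20 and the structure
  theorem `exists_eq_span_mul_fIdeal`);
* `classNumber_eq_card_ringClassGroup` — **`h(D) = |I_K(f)/P_{K,ℤ}(f)|`** (Cox, Thm. 7.7 + Prop. 7.22);
* `toClassGroup_surjective` — **`I_K(f)/P_{K,ℤ}(f) → Cl(𝓞 K)` is onto** (every class contains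
  `𝔞_Q` with `gcd(A, f) = 1`, Cox Lemma 2.25 / (7.25)).

## References

* D. A. Cox, *Primes of the form x² + ny²*, 2nd ed., Wiley (2013), §7.B Thm. 7.7, §7.C Props. 7.19,
  7.20, 7.22, §7.D (7.25), §2.C Lemma 2.25. [cite: Cox2013, §7.C Prop. 7.22]

## Mathlib / tree search

Tree: `OrderCl.classOf'_eq_classOf'_iff`, `fIdeal_mul_negForm`, `reduce_eq_reduce_iff`
(`HallgrenClassGroupOrder(Inj)`), `Reduction.reduce_eq_iff_properEquiv`, `isPosPrim_reduce`,
`isReduced_reduce` (`HallgrenClassGroupReduction`), `BinQF.exists_properEquiv_isPosPrim_isCoprime_a`,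
`eq_of_properEquiv_of_isReduced`, `mem_reducedFormsList_iff`, `classNumber_eq_card`
(`BinaryQuadraticForms*`), `exists_ringHom`, `map_comap_eq`, `comap_map_eq`, `exists_eq_span_mul_fIdeal`,
`sub_intCast_mem_conductor` (`RingClassOrder`), `RingClassGroup`, `prin*`, `toClassGroup` (`RingClassGroup`).
-/

noncomputable section

open scoped QuadraticAlgebra nonZeroDivisors
open Module NumberField QuadraticAlgebra
open Literature.Computability.Cryptography.Hallgren2005
open Literature.Computability.Cryptography.Hallgren2005.OrderCl
open Literature.Computability.Cryptography.Hallgren2005.Reduction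
open Literature.Computability.Cryptography.Hallgren2005.FormComposition (mOf kOf four_mul_mOf two_mul_kOf)
open Literature.NumberTheory.QuadraticFields.Quadratic
open Literature.NumberTheory.QuadraticFields.Quadratic.BinQF

namespace Literature.NumberTheory.QuadraticFields.RingClass

variable {K : Type*} [Field K] [NumberField K]
variable (b : Basis (Fin 2) ℤ (𝓞 K)) (hb : b 0 = 1) {t m : ℤ}
  (hω : b 1 * b 1 = (m : 𝓞 K) + (t : 𝓞 K) * b 1)
variable {f : ℕ} {Δ : NegDiscr} {s : ℤ}
  (hD : Δ.D = (f : ℤ) ^ 2 * (t ^ 2 + 4 * m)) (hs : 2 * s = Δ.D - f * t)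
variable (ι : QO Δ →+* 𝓞 K) (hι : ι ω = (f : 𝓞 K) * b 1 + (s : 𝓞 K))
variable (hf : f ≠ 0)

/-! ### The ideal `𝔄_q = 𝔞_q 𝓞 K` of a form prime to `f` -/

omit [NumberField K] in
/-- `a_q ∈ 𝔄_q`. [cite: Cox2013, §7.C Prop. 7.20] -/
theorem natAbs_mem_map_fIdeal (q : BinQF) : ((q.a : ℤ) : 𝓞 K) ∈ (fIdeal Δ q).map ι := by
  have : ((q.a : ℤ) : 𝓞 K) = ι (q.a : QO Δ) := by rw [map_intCast]
  rw [this]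
  exact Ideal.mem_map_of_mem _ (Ideal.subset_span (by simp))

omit [NumberField K] in
/-- `𝔄_q` is prime to `f` when `gcd(a_q, f) = 1`. [cite: Cox2013, §7.C Lemma 7.18 and Prop. 7.20] -/
theorem map_fIdeal_sup_eq_top {q : BinQF} (hq : IsCoprime q.a (f : ℤ)) :
    (fIdeal Δ q).map ι ⊔ Ideal.span {(f : 𝓞 K)} = ⊤ := by
  have h := span_sup_eq_top_of_sub_mem (K := K) (α := ((q.a : ℤ) : 𝓞 K)) hq
    (by rw [sub_self]; exact Submodule.zero_mem _)
  refine top_le_iff.1 (h ▸ sup_le_sup_right ((Ideal.span_singleton_le_iff_mem _).2 ?_) _)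
  exact natAbs_mem_map_fIdeal ι q

/-- `𝔄_q ≠ 0`. [cite: Cox2013, §7.C Prop. 7.20] -/
theorem map_fIdeal_ne_bot {q : BinQF} (hq : q.IsPosPrim Δ.D) : (fIdeal Δ q).map ι ≠ ⊥ := by
  intro h
  have ha := natAbs_mem_map_fIdeal (K := K) ι q
  rw [h, Ideal.mem_bot, Int.cast_eq_zero] at ha
  exact hq.a_pos.ne' ha

/-- The element `[𝔄_q] ∈ I_K(f)` of a form with `gcd(a_q, f) = 1`. [cite: Cox2013, §7.C Prop. 7.22] -/
theorem mk0_map_fIdeal_mem {q : BinQF} (hq : q.IsPosPrim Δ.D) (hqa : IsCoprime q.a (f : ℤ)) :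
    FractionalIdeal.mk0 K ⟨(fIdeal Δ q).map ι, mem_nonZeroDivisors_of_ne_bot (map_fIdeal_ne_bot ι hq)⟩ ∈
      ringClassNum K f :=
  mk0_mem_ringClassNum (map_fIdeal_sup_eq_top ι hqa) (map_fIdeal_ne_bot ι hq)

/-- The value of the unit `mk0 𝔄_q` is the fractional ideal `𝔄_q`. [cite: Cox2013, §7.C Prop. 7.22] -/
theorem coe_mk0_map_fIdeal {q : BinQF} (hq : q.IsPosPrim Δ.D) :
    ((FractionalIdeal.mk0 K ⟨(fIdeal Δ q).map ι, mem_nonZeroDivisors_of_ne_bot (map_fIdeal_ne_bot ι hq)⟩ :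
      (FractionalIdeal (𝓞 K)⁰ K)ˣ) : FractionalIdeal (𝓞 K)⁰ K) = (((fIdeal Δ q).map ι : Ideal (𝓞 K)) :
        FractionalIdeal (𝓞 K)⁰ K) :=
  FractionalIdeal.coe_mk0 _ _

/-! ### Well-definedness on proper equivalence classes -/

omit [NumberField K] in
include hι in
/-- `ι γ ≡ c (mod f)` for the integer `c = re γ + s · im γ`. [cite: Cox2013, §7.A Lemma 7.2] -/
theorem emb_sub_intCast_mem (γ : QO Δ) :
    ι γ - ((γ.re + γ.im * s : ℤ) : 𝓞 K) ∈ Ideal.span {(f : 𝓞 K)} := by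
  have h := sub_intCast_mem_conductor b ι hι γ
  rw [Ideal.mem_comap, map_sub, map_intCast] at h
  exact h

include hb hι hf in
/-- **Properly equivalent forms (with `a` prime to `f`) give the same class in `I_K(f)/P_{K,ℤ}(f)`.**
If `x𝔞₁ = y𝔞₂` in `O` (Thm. 7.7(ii)), then with `𝔞₂𝔞̄₂ = (a₂)`: `𝔞₁𝔞̄₂ = (γ)`, `a₂𝔞₁ = γ𝔞₂`, and
`γ ≡ c (mod f𝓞 K)` with `c c' ≡ a₁a₂`, so `γ𝓞 K, a₂𝓞 K ∈ P_{K,ℤ}(f)`. [cite: Cox2013, §7.C Prop. 7.22 (proof)] -/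
theorem mk_eq_of_properEquiv {q₁ q₂ : BinQF} (h₁ : q₁.IsPosPrim Δ.D) (h₂ : q₂.IsPosPrim Δ.D)
    (ha₁ : IsCoprime q₁.a (f : ℤ)) (ha₂ : IsCoprime q₂.a (f : ℤ)) (he : q₁.ProperEquiv q₂) :
    (QuotientGroup.mk ⟨_, mk0_map_fIdeal_mem ι h₁ ha₁⟩ : RingClassGroup K f) =
      QuotientGroup.mk ⟨_, mk0_map_fIdeal_mem ι h₂ ha₂⟩ := by
  have hcl : classOf' Δ q₁ = classOf' Δ q₂ :=
    (reduce_eq_reduce_iff Δ h₁ h₂).1 ((reduce_eq_iff_properEquiv Δ.neg h₁ h₂).2 he)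
  obtain ⟨x, y, hx, hy, hxy⟩ := (classOf'_eq_classOf'_iff Δ h₁ h₂).1 hcl
  set 𝔞₁ := fIdeal Δ q₁ with h𝔞₁
  set 𝔞₂ := fIdeal Δ q₂ with h𝔞₂
  set 𝔞₂' := fIdeal Δ (negForm q₂) with h𝔞₂'
  have h22 : 𝔞₂ * 𝔞₂' = Ideal.span {(q₂.a : QO Δ)} := fIdeal_mul_negForm Δ h₂
  have hx1 : Ideal.span {x} * (𝔞₁ * 𝔞₂') = Ideal.span {y * (q₂.a : QO Δ)} := by
    rw [← mul_assoc, hxy, mul_assoc, h22, Ideal.span_singleton_mul_span_singleton]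
  obtain ⟨γ, hγmem, hxγ⟩ := Ideal.mem_span_singleton_mul.1 (hx1 ▸ Ideal.mem_span_singleton_self (y * (q₂.a : QO Δ)))
  have hprod : 𝔞₁ * 𝔞₂' = Ideal.span {γ} := by
    apply (Ideal.span_singleton_mul_right_inj hx).1
    rw [hx1, ← hxγ, Ideal.span_singleton_mul_span_singleton]
  have key : Ideal.span {(q₂.a : QO Δ)} * 𝔞₁ = Ideal.span {γ} * 𝔞₂ := by
    calc Ideal.span {(q₂.a : QO Δ)} * 𝔞₁ = (𝔞₁ * 𝔞₂') * 𝔞₂ := by rw [← h22]; ring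
      _ = Ideal.span {γ} * 𝔞₂ := by rw [hprod]
  -- transport to `𝓞 K`
  have keyK : Ideal.span {((q₂.a : ℤ) : 𝓞 K)} * 𝔞₁.map ι = Ideal.span {ι γ} * 𝔞₂.map ι := by
    have := congrArg (Ideal.map ι) key
    rwa [Ideal.map_mul, Ideal.map_mul, Ideal.map_span, Ideal.map_span, Set.image_singleton,
      Set.image_singleton, map_intCast] at this
  -- `γ ≠ 0`, `γ ≡ c (mod f)` with `c` prime to `f`
  have ha₁0 : (q₁.a : QO Δ) ≠ 0 := intCast_ne_zero Δ h₁.a_pos.ne'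
  have ha₂0 : (q₂.a : QO Δ) ≠ 0 := intCast_ne_zero Δ h₂.a_pos.ne'
  have hmem₁ : (q₁.a : QO Δ) ∈ 𝔞₁ := Ideal.subset_span (by simp)
  have hmem₂' : (q₂.a : QO Δ) ∈ 𝔞₂' := Ideal.subset_span (by simp [negForm])
  have hγ0 : γ ≠ 0 := by
    intro h0
    rw [h0, Ideal.span_singleton_zero, Ideal.mul_eq_bot] at hprod
    rcases hprod with h' | h'
    · rw [h'] at hmem₁; exact ha₁0 ((Submodule.mem_bot _).1 hmem₁)
    · rw [h'] at hmem₂'; exact ha₂0 ((Submodule.mem_bot _).1 hmem₂')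
  have hιγ0 : ι γ ≠ 0 := fun h0 => hγ0 (emb_injective b hb ι hι hf (by rw [h0, map_zero]))
  have ha₂K0 : ((q₂.a : ℤ) : 𝓞 K) ≠ 0 := fun h0 => h₂.a_pos.ne' (intCast_eq_zero_of_basis b hb h0)
  obtain ⟨δ, hδ⟩ : ∃ δ : QO Δ, δ * γ = (q₁.a : QO Δ) * (q₂.a : QO Δ) := by
    rw [← Ideal.mem_span_singleton', ← hprod]
    exact Ideal.mul_mem_mul hmem₁ hmem₂'
  set c : ℤ := γ.re + γ.im * s with hc
  set c' : ℤ := δ.re + δ.im * s with hc'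
  have hγc : ι γ - (c : 𝓞 K) ∈ Ideal.span {(f : 𝓞 K)} := emb_sub_intCast_mem b ι hι γ
  have hδc : ι δ - (c' : 𝓞 K) ∈ Ideal.span {(f : 𝓞 K)} := emb_sub_intCast_mem b ι hι δ
  have hcf : IsCoprime c (f : ℤ) := by
    have hprodK : ((q₁.a * q₂.a : ℤ) : 𝓞 K) - ((c' * c : ℤ) : 𝓞 K) ∈ Ideal.span {(f : 𝓞 K)} := by
      have e : ((q₁.a * q₂.a : ℤ) : 𝓞 K) = ι δ * ι γ := by rw [← map_mul, hδ]; push_cast; rw [map_mul, map_intCast, map_intCast]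
      have : ((q₁.a * q₂.a : ℤ) : 𝓞 K) - ((c' * c : ℤ) : 𝓞 K) = ι δ * (ι γ - c) + (c : 𝓞 K) * (ι δ - c') := by
        rw [e]; push_cast; ring
      rw [this]
      exact Ideal.add_mem _ (Ideal.mul_mem_left _ _ hγc) (Ideal.mul_mem_left _ _ hδc)
    obtain ⟨k, hk⟩ := (intCast_mem_span_iff b hb (q₁.a * q₂.a - c' * c)).1 (by push_cast at hprodK ⊢; exact hprodK)
    have : c' * c = q₁.a * q₂.a + (-k) * f := by linarith
    have hcc : IsCoprime (c' * c) (f : ℤ) := this ▸ (ha₁.mul_left ha₂).add_mul_right_left (-k)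
    exact hcc.of_mul_left_right
  -- conclude in `I_K(f)/P_{K,ℤ}(f)`
  rw [QuotientGroup.eq, Subgroup.mem_subgroupOf]
  show (FractionalIdeal.mk0 K ⟨𝔞₁.map ι, _⟩)⁻¹ * FractionalIdeal.mk0 K ⟨𝔞₂.map ι, _⟩ ∈ ringClassDen K f
  have hunits : prin K ((q₂.a : ℤ) : 𝓞 K) ha₂K0 *
      FractionalIdeal.mk0 K ⟨𝔞₁.map ι, mem_nonZeroDivisors_of_ne_bot (map_fIdeal_ne_bot ι h₁)⟩ =
      prin K (ι γ) hιγ0 * FractionalIdeal.mk0 K ⟨𝔞₂.map ι, mem_nonZeroDivisors_of_ne_bot (map_fIdeal_ne_bot ι h₂)⟩ := by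
    apply Units.ext
    simp only [Units.val_mul, coe_prin', FractionalIdeal.coe_mk0]
    rw [← FractionalIdeal.coeIdeal_mul, ← FractionalIdeal.coeIdeal_mul, keyK]
  set U₁ := FractionalIdeal.mk0 K ⟨𝔞₁.map ι, mem_nonZeroDivisors_of_ne_bot (map_fIdeal_ne_bot ι h₁)⟩ with hU₁
  set U₂ := FractionalIdeal.mk0 K ⟨𝔞₂.map ι, mem_nonZeroDivisors_of_ne_bot (map_fIdeal_ne_bot ι h₂)⟩ with hU₂
  set P := prin K ((q₂.a : ℤ) : 𝓞 K) ha₂K0 with hP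
  set Q := prin K (ι γ) hιγ0 with hQ
  have hrel : U₁⁻¹ * U₂ = Q⁻¹ * P := by
    calc U₁⁻¹ * U₂ = U₁⁻¹ * (Q⁻¹ * (Q * U₂)) := by rw [inv_mul_cancel_left]
      _ = U₁⁻¹ * (Q⁻¹ * (P * U₁)) := by rw [hunits]
      _ = Q⁻¹ * P := by rw [mul_comm P U₁, mul_left_comm Q⁻¹ U₁ P, inv_mul_cancel_left]
  rw [hrel]
  exact Subgroup.mul_mem _ (Subgroup.inv_mem _ (prin_mem_ringClassDen hιγ0 hcf hγc))
    (prin_mem_ringClassDen ha₂K0 ha₂ (by rw [sub_self]; exact Submodule.zero_mem _))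

/-! ### Injectivity: equal classes force proper equivalence (Cox, Prop. 7.20 + Thm. 7.7(ii)) -/

omit [NumberField K] in
include hb hι in
/-- An element `β ≡ b (mod f𝓞 K)`, `b ∈ ℤ`, lies in `ℤ + f𝓞 K = ι(O)`. [cite: Cox2013, §7.A Lemma 7.2] -/
theorem exists_emb_eq_of_sub_intCast_mem {β : 𝓞 K} {c : ℤ} (h : β - (c : 𝓞 K) ∈ Ideal.span {(f : 𝓞 K)}) :
    ∃ y : QO Δ, ι y = β := by
  obtain ⟨w, hw⟩ := mem_range_of_mem_span b hb ι hι _ h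
  exact ⟨w + c, by rw [map_add, hw, map_intCast]; ring⟩

omit [NumberField K] in
/-- `y · 𝔞_q` is prime to the conductor when `ι y ≡ b (mod f)`, `gcd(b, f) = 1 = gcd(a_q, f)`.
[cite: Cox2013, §7.C Lemma 7.18] -/
theorem span_mul_fIdeal_sup_conductor_eq_top {y : QO Δ} {c : ℤ} (hc : IsCoprime c (f : ℤ))
    (hy : ι y - (c : 𝓞 K) ∈ Ideal.span {(f : 𝓞 K)}) {q : BinQF} (hqa : IsCoprime q.a (f : ℤ)) :
    Ideal.span {y} * fIdeal Δ q ⊔ (Ideal.span {(f : 𝓞 K)}).comap ι = ⊤ := by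
  rw [Ideal.eq_top_iff_one]
  obtain ⟨u, v, huv⟩ := hc.mul_left hqa
  have hya : y * (q.a : QO Δ) ∈ Ideal.span {y} * fIdeal Δ q :=
    Ideal.mul_mem_mul (Ideal.mem_span_singleton_self y) (Ideal.subset_span (by simp))
  have hdiff : y * (q.a : QO Δ) - ((c * q.a : ℤ) : QO Δ) ∈ (Ideal.span {(f : 𝓞 K)}).comap ι := by
    rw [Ideal.mem_comap, map_sub, map_mul, map_intCast, map_intCast]
    have : ι y * ((q.a : ℤ) : 𝓞 K) - ((c * q.a : ℤ) : 𝓞 K) = (ι y - (c : 𝓞 K)) * ((q.a : ℤ) : 𝓞 K) := by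
      push_cast; ring
    rw [this]
    exact Ideal.mul_mem_right _ _ hy
  have hfmem : ((f : ℤ) : QO Δ) ∈ (Ideal.span {(f : 𝓞 K)}).comap ι := by
    rw [Ideal.mem_comap, map_intCast]; push_cast; exact Ideal.mem_span_singleton_self _
  have h1 : (1 : QO Δ) = (u : QO Δ) * (y * (q.a : QO Δ)) - (u : QO Δ) * (y * (q.a : QO Δ) - ((c * q.a : ℤ) : QO Δ))
      + (v : QO Δ) * ((f : ℤ) : QO Δ) := by
    have := congrArg (Int.cast : ℤ → QO Δ) huv
    push_cast at this ⊢
    linear_combination -this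
  rw [h1]
  exact Submodule.add_mem _ (Submodule.sub_mem _ (Ideal.mem_sup_left (Ideal.mul_mem_left _ _ hya))
    (Ideal.mem_sup_right (Ideal.mul_mem_left _ _ hdiff))) (Ideal.mem_sup_right (Ideal.mul_mem_left _ _ hfmem))

include hb hι hf in
/-- **Injectivity** (Cox, Prop. 7.22): if `[𝔄_{q₁}] = [𝔄_{q₂}]` in `I_K(f)/P_{K,ℤ}(f)` then `q₁ ∼ q₂`:
`𝔄₂ β'𝓞 K = 𝔄₁ β𝓞 K` with `β = ι y`, `β' = ι y'`; pulling back to `O` (`comap_map_eq`) gives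
`y'𝔞₂ = y𝔞₁`, i.e. `[𝔞₁] = [𝔞₂]` in `C(O)`, and Thm. 7.7(ii). [cite: Cox2013, §7.C Prop. 7.22 (proof)] -/
theorem properEquiv_of_mk_eq {q₁ q₂ : BinQF} (h₁ : q₁.IsPosPrim Δ.D) (h₂ : q₂.IsPosPrim Δ.D)
    (ha₁ : IsCoprime q₁.a (f : ℤ)) (ha₂ : IsCoprime q₂.a (f : ℤ))
    (heq : (QuotientGroup.mk ⟨_, mk0_map_fIdeal_mem ι h₁ ha₁⟩ : RingClassGroup K f) =
      QuotientGroup.mk ⟨_, mk0_map_fIdeal_mem ι h₂ ha₂⟩) : q₁.ProperEquiv q₂ := by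
  rw [QuotientGroup.eq, Subgroup.mem_subgroupOf] at heq
  have heq' : (FractionalIdeal.mk0 K ⟨(fIdeal Δ q₁).map ι, mem_nonZeroDivisors_of_ne_bot (map_fIdeal_ne_bot ι h₁)⟩)⁻¹ *
      FractionalIdeal.mk0 K ⟨(fIdeal Δ q₂).map ι, mem_nonZeroDivisors_of_ne_bot (map_fIdeal_ne_bot ι h₂)⟩ ∈
      ringClassDen K f := heq
  obtain ⟨p, ⟨β, c, hc, hβ, hp⟩, p', ⟨β', c', hc', hβ', hp'⟩, hpp⟩ := exists_eq_mul_inv_of_mem_ringClassDen heq'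
  -- `𝔄₂ · (β') = 𝔄₁ · (β)` as ideals of `𝓞 K`
  rw [eq_mul_inv_iff_mul_eq, mul_assoc, inv_mul_eq_iff_eq_mul] at hpp
  have hval := congrArg (fun u : (FractionalIdeal (𝓞 K)⁰ K)ˣ => (u : FractionalIdeal (𝓞 K)⁰ K)) hpp
  simp only [Units.val_mul, FractionalIdeal.coe_mk0, hp, hp', ← FractionalIdeal.coeIdeal_span_singleton,
    ← FractionalIdeal.coeIdeal_mul, FractionalIdeal.coeIdeal_inj] at hval
  -- hval : map 𝔞₂ * span {β'} = map 𝔞₁ * span {β}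
  obtain ⟨y, rfl⟩ := exists_emb_eq_of_sub_intCast_mem b hb ι hι hβ
  obtain ⟨y', rfl⟩ := exists_emb_eq_of_sub_intCast_mem b hb ι hι hβ'
  have hO : (Ideal.span {y'} * fIdeal Δ q₂).map ι = (Ideal.span {y} * fIdeal Δ q₁).map ι := by
    rw [Ideal.map_mul, Ideal.map_mul, Ideal.map_span, Ideal.map_span, Set.image_singleton, Set.image_singleton,
      mul_comm, hval, mul_comm]
  have hO' : Ideal.span {y'} * fIdeal Δ q₂ = Ideal.span {y} * fIdeal Δ q₁ := by
    rw [← comap_map_eq b hb ι hι hf (span_mul_fIdeal_sup_conductor_eq_top ι hc' hβ' ha₂), hO,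
      comap_map_eq b hb ι hι hf (span_mul_fIdeal_sup_conductor_eq_top ι hc hβ ha₁)]
  have hy0 : y ≠ 0 := by
    rintro rfl
    rw [map_zero] at hp
    exact Units.ne_zero p (by rw [hp]; simp)
  have hy'0 : y' ≠ 0 := by
    rintro rfl
    rw [map_zero] at hp'
    exact Units.ne_zero p' (by rw [hp']; simp)
  have hcl : classOf' Δ q₁ = classOf' Δ q₂ := (classOf'_eq_classOf'_iff Δ h₁ h₂).2 ⟨y, y', hy0, hy'0, hO'.symm⟩
  exact (reduce_eq_iff_properEquiv Δ.neg h₁ h₂).1 ((reduce_eq_reduce_iff Δ h₁ h₂).2 hcl)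

/-! ### Surjectivity onto `I_K(f)/P_{K,ℤ}(f)` (Cox, Prop. 7.20 with Thm. 7.7(i)) -/

include hb hω hD hι in
/-- **Every class of `I_K(f)/P_{K,ℤ}(f)` is the class of `𝔄_q`** for a primitive positive definite form
`q` of discriminant `D` with `gcd(a_q, f) = 1` (for `f𝓞 K ≠ 𝓞 K`): write the class as `[𝔄𝔅']` with
`𝔄𝔅'` integral and prime to `f`, and `𝔄𝔅' ∩ O = g · 𝔞_q`. [cite: Cox2013, §7.C Props. 7.20, 7.22] -/
theorem exists_form_mk_eq (hf1 : Ideal.span {(f : 𝓞 K)} ≠ ⊤) (g : RingClassGroup K f) :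
    ∃ q : BinQF, ∃ hq : q.IsPosPrim Δ.D, ∃ hqa : IsCoprime q.a (f : ℤ),
      g = QuotientGroup.mk ⟨_, mk0_map_fIdeal_mem ι hq hqa⟩ := by
  obtain ⟨u, rfl⟩ := QuotientGroup.mk_surjective g
  obtain ⟨sA, ⟨𝔄, h𝔄, hs⟩, sB, ⟨𝔅, h𝔅, ht⟩, hu⟩ := exists_eq_mul_inv_of_mem_ringClassNum u.2
  obtain ⟨h𝔄0, rfl⟩ := eq_mk0_of_coe_eq hs
  obtain ⟨h𝔅0, rfl⟩ := eq_mk0_of_coe_eq ht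
  -- `n ∈ 𝔅 ∩ ℤ` prime to `f`, `(n) = 𝔅𝔅'`
  obtain ⟨n, hn𝔅, hn⟩ := exists_intCast_mem_of_sup_eq_top b hb hω h𝔅
  have hn0 : (n : 𝓞 K) ≠ 0 := by exact_mod_cast ne_zero_of_isCoprime hf1 hn
  obtain ⟨𝔅', h𝔅𝔅'⟩ := Ideal.dvd_iff_le.2 ((Ideal.span_singleton_le_iff_mem _).2 hn𝔅)
  have hnf : Ideal.span {(n : 𝓞 K)} ⊔ Ideal.span {(f : 𝓞 K)} = ⊤ :=
    span_sup_eq_top_of_sub_mem hn (by rw [sub_self]; exact Submodule.zero_mem _)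
  have h𝔅' : 𝔅' ⊔ Ideal.span {(f : 𝓞 K)} = ⊤ := by
    refine top_le_iff.1 (hnf ▸ sup_le_sup_right ?_ _)
    exact Ideal.dvd_iff_le.1 ⟨𝔅, by rw [h𝔅𝔅', mul_comm]⟩
  have h𝔅'0 : 𝔅' ≠ ⊥ := by
    rintro rfl
    rw [Ideal.mul_bot] at h𝔅𝔅'
    exact hn0 (Ideal.span_singleton_eq_bot.1 h𝔅𝔅')
  set J : Ideal (𝓞 K) := 𝔄 * 𝔅' with hJ
  have hJf : J ⊔ Ideal.span {(f : 𝓞 K)} = ⊤ := mul_sup_eq_top h𝔄 h𝔅'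
  -- `J ∩ O = g · 𝔞_q`
  obtain ⟨n', hn'J, hn'⟩ := exists_intCast_mem_of_sup_eq_top b hb hω hJf
  have hn'𝔟 : ((n' : ℤ) : QO Δ) ∈ J.comap ι := by rw [Ideal.mem_comap, map_intCast]; exact hn'J
  have h𝔟0 : J.comap ι ≠ ⊥ := by
    intro h0
    rw [h0, Ideal.mem_bot] at hn'𝔟
    exact intCast_ne_zero Δ (ne_zero_of_isCoprime hf1 hn') hn'𝔟
  obtain ⟨g, q, hg, hq, hgq, h𝔟⟩ := exists_eq_span_mul_fIdeal b hb hD ι hι hn'𝔟 hn' h𝔟0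
  have hJeq : J = Ideal.span {((g : ℤ) : 𝓞 K)} * (fIdeal Δ q).map ι := by
    rw [← map_comap_eq b hb ι hι hJf, h𝔟, Ideal.map_mul, Ideal.map_span, Set.image_singleton, map_intCast]
  have hg0 : ((g : ℤ) : 𝓞 K) ≠ 0 := fun h0 => hg.ne' (intCast_eq_zero_of_basis b hb h0)
  refine ⟨q, hq, hgq.of_mul_left_right, ?_⟩
  rw [QuotientGroup.eq, Subgroup.mem_subgroupOf]
  show (u : (FractionalIdeal (𝓞 K)⁰ K)ˣ)⁻¹ *
      FractionalIdeal.mk0 K ⟨(fIdeal Δ q).map ι, mem_nonZeroDivisors_of_ne_bot (map_fIdeal_ne_bot ι hq)⟩ ∈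
    ringClassDen K f
  -- units bookkeeping: `u = (g) · [𝔄_q] · (n)⁻¹`
  have ht' : FractionalIdeal.mk0 K ⟨𝔅, mem_nonZeroDivisors_of_ne_bot h𝔅0⟩ *
      FractionalIdeal.mk0 K ⟨𝔅', mem_nonZeroDivisors_of_ne_bot h𝔅'0⟩ = prin K (n : 𝓞 K) hn0 := by
    apply Units.ext
    rw [Units.val_mul, FractionalIdeal.coe_mk0, FractionalIdeal.coe_mk0, coe_prin', h𝔅𝔅',
      FractionalIdeal.coeIdeal_mul]
  have hsJ : FractionalIdeal.mk0 K ⟨𝔄, mem_nonZeroDivisors_of_ne_bot h𝔄0⟩ *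
      FractionalIdeal.mk0 K ⟨𝔅', mem_nonZeroDivisors_of_ne_bot h𝔅'0⟩ =
      prin K ((g : ℤ) : 𝓞 K) hg0 *
        FractionalIdeal.mk0 K ⟨(fIdeal Δ q).map ι, mem_nonZeroDivisors_of_ne_bot (map_fIdeal_ne_bot ι hq)⟩ := by
    apply Units.ext
    rw [Units.val_mul, Units.val_mul, FractionalIdeal.coe_mk0, FractionalIdeal.coe_mk0, FractionalIdeal.coe_mk0,
      coe_prin', ← FractionalIdeal.coeIdeal_mul, ← FractionalIdeal.coeIdeal_mul, ← hJ, hJeq]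
  have htinv : (FractionalIdeal.mk0 K ⟨𝔅, mem_nonZeroDivisors_of_ne_bot h𝔅0⟩)⁻¹ =
      FractionalIdeal.mk0 K ⟨𝔅', mem_nonZeroDivisors_of_ne_bot h𝔅'0⟩ * (prin K (n : 𝓞 K) hn0)⁻¹ := by
    rw [← ht', mul_inv_rev, mul_inv_cancel_left]
  set Uq := FractionalIdeal.mk0 K ⟨(fIdeal Δ q).map ι, mem_nonZeroDivisors_of_ne_bot (map_fIdeal_ne_bot ι hq)⟩
  have hu' : (u : (FractionalIdeal (𝓞 K)⁰ K)ˣ) = prin K ((g : ℤ) : 𝓞 K) hg0 * Uq * (prin K (n : 𝓞 K) hn0)⁻¹ := by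
    rw [hu, htinv, ← mul_assoc, hsJ]
  rw [hu', mul_inv_rev, mul_inv_rev, inv_inv, mul_assoc, mul_assoc, mul_left_comm Uq⁻¹, inv_mul_cancel, mul_one]
  exact Subgroup.mul_mem _ (prin_mem_ringClassDen hn0 hn (by rw [sub_self]; exact Submodule.zero_mem _))
    (Subgroup.inv_mem _ (prin_mem_ringClassDen hg0 hgq.of_mul_left_left (by rw [sub_self]; exact Submodule.zero_mem _)))

/-! ### `h(D) = |I_K(f)/P_{K,ℤ}(f)|` -/

include hb hω hD hι hf in
/-- **Cox, Thm. 7.7 with Prop. 7.22: `h(f² d_K) = |I_K(f)/P_{K,ℤ}(f)|`** (for `f ≥ 2`; here `h` is the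
number of reduced primitive positive definite forms of discriminant `D = f² d_K`). The bijection sends
a reduced form `q` to `[𝔄_{q'}]` for any `q' ∼ q` with `gcd(a_{q'}, f) = 1` (Cox, Lemma 2.25).
[cite: Cox2013, §7.C Prop. 7.22 and §7.B Thm. 7.7(ii)] -/
theorem classNumber_eq_card_ringClassGroup (hf1 : Ideal.span {(f : 𝓞 K)} ≠ ⊤) :
    BinQF.classNumber Δ.D = Nat.card (RingClassGroup K f) := by
  classical
  have hfZ : (f : ℤ) ≠ 0 := by exact_mod_cast hf
  have hrep : ∀ q : BinQF, q.IsPosPrim Δ.D →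
      ∃ q' : BinQF, q.ProperEquiv q' ∧ q'.IsPosPrim Δ.D ∧ IsCoprime q'.a (f : ℤ) :=
    fun q hq => exists_properEquiv_isPosPrim_isCoprime_a Δ.neg hq hfZ
  have hR : ∀ q : {q : BinQF // q ∈ (reducedFormsList Δ.D).toFinset},
      (q : BinQF).IsPosPrim Δ.D ∧ (q : BinQF).IsReduced :=
    fun q => (mem_reducedFormsList_iff _ Δ.neg).1 (List.mem_toFinset.1 q.2)
  have hrep' : ∀ q : {q : BinQF // q ∈ (reducedFormsList Δ.D).toFinset},
      (q : BinQF).ProperEquiv (hrep q (hR q).1).choose ∧ ((hrep q (hR q).1).choose).IsPosPrim Δ.D ∧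
        IsCoprime ((hrep q (hR q).1).choose).a (f : ℤ) :=
    fun q => (hrep q (hR q).1).choose_spec
  let Φ : {q : BinQF // q ∈ (reducedFormsList Δ.D).toFinset} → RingClassGroup K f :=
    fun q => QuotientGroup.mk ⟨_, mk0_map_fIdeal_mem ι (hrep' q).2.1 (hrep' q).2.2⟩
  have hΦ : Function.Bijective Φ := by
    constructor
    · intro q₁ q₂ h
      have he := properEquiv_of_mk_eq b hb ι hι hf (hrep' q₁).2.1 (hrep' q₂).2.1 (hrep' q₁).2.2 (hrep' q₂).2.2 h
      have : (q₁ : BinQF).ProperEquiv q₂ := (hrep' q₁).1.trans (he.trans (hrep' q₂).1.symm)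
      exact Subtype.ext (eq_of_properEquiv_of_isReduced (hR q₁).1 (hR q₂).1 (hR q₁).2 (hR q₂).2 this)
    · intro g
      obtain ⟨q, hq, hqa, rfl⟩ := exists_form_mk_eq b hb hω hD ι hι hf1 g
      let qr : {q : BinQF // q ∈ (reducedFormsList Δ.D).toFinset} :=
        ⟨reduce q, List.mem_toFinset.2 ((mem_reducedFormsList_iff _ Δ.neg).2
          ⟨isPosPrim_reduce Δ.neg hq, isReduced_reduce Δ.neg hq⟩)⟩
      refine ⟨qr, ?_⟩
      have he : ((hrep qr (hR qr).1).choose).ProperEquiv q :=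
        (hrep' qr).1.symm.trans (properEquiv_reduce q).symm
      exact mk_eq_of_properEquiv b hb ι hι hf (hrep' qr).2.1 hq (hrep' qr).2.2 hqa he
  rw [classNumber_eq_card, ← Nat.card_eq_of_bijective Φ hΦ, Nat.card_eq_fintype_card, Fintype.card_coe]

/-! ### `I_K(f)/P_{K,ℤ}(f) → Cl(𝓞 K)` is onto -/

include hb hω in
/-- **Every ideal class of an imaginary quadratic field contains an ideal prime to `f`**, hence
`toClassGroup : I_K(f)/P_{K,ℤ}(f) → Cl(𝓞 K)` is surjective: a class is `[g·(A, ω − k)]` (structure of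
ideals), the form `(A, 2k − t, C)` of discriminant `d_K` is properly equivalent to one with
`gcd(A', f) = 1` (Cox, Lemma 2.25), and properly equivalent forms have equivalent ideals (Thm. 7.7(ii),
transported from `O_{d_K} ≅ 𝓞 K`). [cite: Cox2013, §7.D (7.25) and §2.C Lemma 2.25] -/
theorem toClassGroup_surjective (hneg : t ^ 2 + 4 * m < 0) (hf0 : f ≠ 0) :
    Function.Surjective (toClassGroup K f) := by
  classical
  -- the order of discriminant `d_K` itself (`f = 1`)
  let Δ₀ : NegDiscr := ⟨t ^ 2 + 4 * m, hneg⟩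
  have hD₀ : Δ₀.D = ((1 : ℕ) : ℤ) ^ 2 * (t ^ 2 + 4 * m) := by simp [Δ₀]
  obtain ⟨s₀, hs₀⟩ : ∃ s₀ : ℤ, 2 * s₀ = Δ₀.D - (1 : ℕ) * t := by
    obtain ⟨c, hc⟩ := two_dvd_sub hD₀; exact ⟨c, hc.symm⟩
  obtain ⟨ι₀, hι₀⟩ := exists_ringHom b hω hD₀ hs₀
  intro c
  obtain ⟨⟨J, hJ⟩, rfl⟩ := ClassGroup.mk0_surjective c
  have hJ0 : J ≠ ⊥ := nonZeroDivisors.ne_zero hJ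
  obtain ⟨g, A, k, C, hg, hA, hAC, hJeq⟩ := exists_eq_span_singleton_mul_span_pair b hb hω hJ0
  -- the form `Q = (A, 2(k+s₀) − d_K, C)` of discriminant `d_K` (in the coordinates of `O_{d_K}`), primitive
  have hsq := sq_add_eq hD₀ hs₀
  have hAC' : A * C = (k + s₀) ^ 2 - Δ₀.D * (k + s₀) - mOf Δ₀.D := by
    have h2 : (2 : ℤ) * s₀ = Δ₀.D - t := by simpa using hs₀
    have hsq' : s₀ ^ 2 + m = mOf Δ₀.D + Δ₀.D * s₀ := by simpa using hsq
    linear_combination hAC - k * h2 - hsq'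
  obtain ⟨hdisc, hkOf⟩ := disc_mk_eq hD₀ hAC'
  set Q : BinQF := ⟨A, 2 * (k + s₀) - Δ₀.D, C⟩ with hQdef
  have hQ : Q.IsPosPrim Δ₀.D := by
    refine ⟨hdisc, hA, ?_⟩
    rw [BinQF.isPrimitive_iff]
    intro d hdA hdB hdC
    have hdisc' : (2 * (k + s₀) - Δ₀.D) ^ 2 - 4 * A * C = t ^ 2 + 4 * m := by
      have := hdisc; rw [BinQF.disc] at this; simpa [Δ₀] using this
    exact isUnit_of_dvd_of_disc_eq b hb hω hdisc' hdA hdB hdC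
  have hmapQ : (fIdeal Δ₀ Q).map ι₀ = Ideal.span {(A : 𝓞 K), b 1 - (k : 𝓞 K)} := by
    rw [fIdeal, hkOf, Ideal.map_span, Set.image_pair, map_intCast, map_sub, hι₀, map_intCast]
    congr 2
    push_cast
    ring
  -- a properly equivalent form with `gcd(A', f) = 1`
  have hfZ : (f : ℤ) ≠ 0 := by exact_mod_cast hf0
  obtain ⟨Q', hQQ', hQ', hQ'a⟩ := exists_properEquiv_isPosPrim_isCoprime_a Δ₀.neg hQ hfZ
  have hcl : classOf' Δ₀ Q = classOf' Δ₀ Q' :=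
    (reduce_eq_reduce_iff Δ₀ hQ hQ').1 ((reduce_eq_iff_properEquiv Δ₀.neg hQ hQ').2 hQQ')
  obtain ⟨x, y, hx, hy, hxy⟩ := (classOf'_eq_classOf'_iff Δ₀ hQ hQ').1 hcl
  have hxyK : Ideal.span {ι₀ x} * Ideal.span {(A : 𝓞 K), b 1 - (k : 𝓞 K)} =
      Ideal.span {ι₀ y} * (fIdeal Δ₀ Q').map ι₀ := by
    have := congrArg (Ideal.map ι₀) hxy
    rwa [Ideal.map_mul, Ideal.map_mul, Ideal.map_span, Ideal.map_span, Set.image_singleton,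
      Set.image_singleton, hmapQ] at this
  have hι₀inj := emb_injective b hb ι₀ hι₀ one_ne_zero
  have hx0 : ι₀ x ≠ 0 := fun h => hx (hι₀inj (by rw [h, map_zero]))
  have hy0 : ι₀ y ≠ 0 := fun h => hy (hι₀inj (by rw [h, map_zero]))
  have hg0 : (g : 𝓞 K) ≠ 0 := fun h0 => hg.ne' (intCast_eq_zero_of_basis b hb h0)
  refine ⟨QuotientGroup.mk ⟨_, mk0_map_fIdeal_mem ι₀ hQ' hQ'a⟩, ?_⟩
  rw [toClassGroup_mk, ClassGroup.mk_mk0, ClassGroup.mk0_eq_mk0_iff]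
  refine ⟨(g : 𝓞 K) * ι₀ y, ι₀ x, mul_ne_zero hg0 hy0, hx0, ?_⟩
  change Ideal.span {(g : 𝓞 K) * ι₀ y} * (fIdeal Δ₀ Q').map ι₀ = Ideal.span {ι₀ x} * J
  rw [← Ideal.span_singleton_mul_span_singleton, mul_assoc, ← hxyK, hJeq]
  ring

end Literature.NumberTheory.QuadraticFields.RingClass
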